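import Summits.Ventures.YMGap.RobustBall.CentreProjection
import Literature.MathematicalPhysics.QuantumLattice.GaugeGroupsProofs
import HarnessLib

/-!
# Robust ball (Y2), §6(c) — THE CENTRE OF `SU(N)` IS `ℤ_N`: rb-theory's `IsCentreBlind` = the proofs' `IsTwistBlind`

HONEST FRAMING: venture file of the cell `pub-ymgap` (QuantumFields programme), track ROBUST-BALL / DS seat ds-4 (g7).
Finite-dimensional linear algebra; nothing about the continuum, a spectral mass gap, or Clay.

WHAT.  rb-theory's reserved predicate `IsCentreBlind W` (`CentreTwist`) asks invariance of `W.total` under linkwise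
multiplication by ARBITRARY central elements of `SU(N)`; the centre-projection chain (`CentreProjection` …
`CentreBlindAreaLaw`) runs on the concrete twists `centreOf a = ψ(a)·1`, `a : ℤ/N` (`IsTwistBlind W`), and membership of
named actions (adjoint, mixed) was proved in that weaker-looking form.  Here the gap is closed: by Schur's lemma in
its elementary matrix form, EVERY central element of `SU(N)` is `centreOf a` for some `a : ℤ/N`
(`exists_centreOf_eq_of_mem_center`, `mem_center_iff_exists_centreOf`), hence
`IsCentreBlind W ↔ IsTwistBlind W` (`isCentreBlind_iff_isTwistBlind`) and every plaquette action through a density with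
`f (centreOf a * g) = f g` is centre-blind in rb-theory's sense (`isCentreBlind_of_plaquetteAction'`).
PROOF (Bröcker–tom Dieck IV (3.1)/(3.3) ingredients, as vendored in the tree's `GaugeGroupsProofs`): a central `z` commutes
with the torus element `diag(…, i, …, −i, …)` (`diagonal_pairFun_mem`), so its off-diagonal entries vanish; it commutes
with the signed transpositions `sSwap a b`, whose conjugation permutes diagonal entries (`coe_sSwap_conj`), so its
diagonal entries coincide; so `z = c·1` with `c^N = det z = 1`, and the `N`-th roots of unity are the values of `ψ`
(`Complex.isPrimitiveRoot_exp`).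

References: T. Bröcker, T. tom Dieck, GTM 98 (1985) IV (3.1), (3.3) [BrockerTomDieck1985].
-/

noncomputable section

open Matrix Complex
open Literature.MathematicalPhysics.QuantumLattice (pairFun diagonal_pairFun_mem sSwap coe_sSwap_conj circleOfNormEqOne
  prod_eq_one_of_coe_eq_diagonal)
open Literature.MathematicalPhysics.QuantumFieldTheory

namespace Summit.Ventures.YMGap.RobustBall

variable {d L N : ℕ}

/-! ### Schur: the centre of `SU(N)` consists of the `centreOf a` -/

section Schur

/-- Off-diagonal entries of a central element of `SU(N)` vanish (it commutes with `diag(…, i, …, −i, …)`).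
[cite: BrockerTomDieck1985, IV (3.1)] -/
theorem apply_eq_zero_of_mem_center {z : SUN N} (hz : z ∈ Subgroup.center (SUN N)) {i j : Fin N}
    (hij : i ≠ j) : (z : Matrix (Fin N) (Fin N) ℂ) i j = 0 := by
  set w : Circle := circleOfNormEqOne I (by simp) with hw
  set D : SUN N := ⟨diagonal (pairFun i j (w : ℂ)), diagonal_pairFun_mem i j w⟩ with hD
  have hcomm : z * D = D * z := (Subgroup.mem_center_iff.1 hz D).symm
  have h := congrArg (fun g : SUN N => (g : Matrix (Fin N) (Fin N) ℂ) i j) hcomm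
  simp only [Submonoid.coe_mul, hD, mul_diagonal, diagonal_mul] at h
  have hwI : ((w : Circle) : ℂ) = I := rfl
  have hi' : pairFun i j ((w : Circle) : ℂ) i = I := by
    rw [pairFun, Pi.mul_apply, Pi.mulSingle_eq_same, Pi.mulSingle_eq_of_ne hij, mul_one, hwI]
  have hj' : pairFun i j ((w : Circle) : ℂ) j = -I := by
    rw [pairFun, Pi.mul_apply, Pi.mulSingle_eq_of_ne (Ne.symm hij), Pi.mulSingle_eq_same, one_mul, hwI,
      Complex.inv_I]
  rw [hi', hj'] at h
  have h2 : (z : Matrix (Fin N) (Fin N) ℂ) i j * (2 * I) = 0 := by linear_combination -h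
  exact (mul_eq_zero.1 h2).resolve_right (mul_ne_zero two_ne_zero Complex.I_ne_zero)

/-- A central element of `SU(N)` is the diagonal matrix of its diagonal entries. [folklore] -/
theorem coe_eq_diagonal_of_mem_center {z : SUN N} (hz : z ∈ Subgroup.center (SUN N)) :
    (z : Matrix (Fin N) (Fin N) ℂ) = diagonal fun k => (z : Matrix (Fin N) (Fin N) ℂ) k k := by
  ext k l
  by_cases hkl : k = l
  · subst hkl; rw [diagonal_apply_eq]
  · rw [diagonal_apply_ne _ hkl, apply_eq_zero_of_mem_center hz hkl]

/-- Diagonal entries of a central element of `SU(N)` coincide (it commutes with the signed transpositions, whose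
conjugation permutes the diagonal). [cite: BrockerTomDieck1985, IV (3.3)] -/
theorem apply_eq_apply_of_mem_center {z : SUN N} (hz : z ∈ Subgroup.center (SUN N)) (a b : Fin N) :
    (z : Matrix (Fin N) (Fin N) ℂ) a a = (z : Matrix (Fin N) (Fin N) ℂ) b b := by
  have hconj : sSwap a b * z * (sSwap a b)⁻¹ = z := by
    rw [Subgroup.mem_center_iff.1 hz (sSwap a b), mul_inv_cancel_right]
  have h := coe_sSwap_conj (coe_eq_diagonal_of_mem_center hz) a b
  rw [hconj] at h
  have h' := congrArg (fun M : Matrix (Fin N) (Fin N) ℂ => M a a) h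
  simpa only [diagonal_apply_eq, Function.comp_apply, Equiv.swap_apply_left] using h'

variable [NeZero N]

/-- **SCHUR FOR `SU(N)`: every central element is `centreOf a = ψ(a)·1` for some `a : ℤ/N`.**
[cite: BrockerTomDieck1985, IV (3.1)] -/
theorem exists_centreOf_eq_of_mem_center {z : SUN N} (hz : z ∈ Subgroup.center (SUN N)) :
    ∃ a : ZMod N, centreOf a = z := by
  set c : ℂ := (z : Matrix (Fin N) (Fin N) ℂ) 0 0 with hc
  have hZ : (z : Matrix (Fin N) (Fin N) ℂ) = diagonal fun _ => c := by
    rw [coe_eq_diagonal_of_mem_center hz]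
    congr 1
    funext k
    exact apply_eq_apply_of_mem_center hz k 0
  have hcN : c ^ N = 1 := by
    have h := prod_eq_one_of_coe_eq_diagonal hZ
    rwa [Finset.prod_const, Finset.card_univ, Fintype.card_fin] at h
  obtain ⟨i, -, hi⟩ := (Complex.isPrimitiveRoot_exp N (NeZero.ne N)).eq_pow_of_pow_eq_one hcN
  refine ⟨(i : ZMod N), Subtype.ext ?_⟩
  have hψ : ψ N (i : ZMod N) = c := by
    rw [← hi, ψ, ZMod.stdAddChar_apply, ZMod.toCircle_natCast, ← Complex.exp_nat_mul]
    congr 1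
    ring
  rw [coe_centreOf, hZ, hψ, smul_one_eq_diagonal]

/-- **The centre of `SU(N)` is `{centreOf a : a ∈ ℤ/N} ≅ ℤ_N`.** [cite: BrockerTomDieck1985, IV (3.1)] -/
theorem mem_center_iff_exists_centreOf {z : SUN N} :
    z ∈ Subgroup.center (SUN N) ↔ ∃ a : ZMod N, centreOf a = z :=
  ⟨exists_centreOf_eq_of_mem_center, fun ⟨a, ha⟩ => ha ▸ centreOf_mem_center a⟩

end Schur

/-! ### `IsCentreBlind ↔ IsTwistBlind` -/

/-- **Twist-blind implies centre-blind** (rb-theory's reserved predicate): a centre-valued `ζ : links → Z(SU(N))` is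
`twistOf k` for `k e` with `centreOf (k e) = ζ e`. [folklore] -/
theorem IsTwistBlind.isCentreBlind [NeZero L] [NeZero N] {W : Perturbation d L N} (h : IsTwistBlind W) :
    IsCentreBlind W := by
  intro ζ hζ U
  choose k hk using fun e => exists_centreOf_eq_of_mem_center (hζ e)
  have hζk : (fun e => ζ e * U e) = twistOf k * U := funext fun e => by rw [Pi.mul_apply, twistOf, hk e]
  rw [hζk]
  exact h k U

/-- **`IsCentreBlind W ↔ IsTwistBlind W`**: rb-theory's §6(c) predicate and the hypothesis of the centre-projection
chain coincide. [folklore] -/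
theorem isCentreBlind_iff_isTwistBlind [NeZero L] [NeZero N] (W : Perturbation d L N) :
    IsCentreBlind W ↔ IsTwistBlind W :=
  ⟨IsCentreBlind.isTwistBlind, IsTwistBlind.isCentreBlind⟩

/-- **Plaquette actions through `centreOf`-invariant densities are centre-blind in rb-theory's sense**:
`W.total U = ∑_q f(U_q)` with `f (centreOf a * g) = f g` for all `a : ℤ/N` (e.g. the adjoint density `|tr g|² − 1`, the
`SU(2)` mixed density `(Re tr g)²`, at ANY coupling). [folklore] -/
theorem isCentreBlind_of_plaquetteAction' [NeZero L] [NeZero N] {W : Perturbation d L N} {f : SUN N → ℝ}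
    (hW : IsPlaquetteAction f W) (hf : ∀ (a : ZMod N) (g : SUN N), f (centreOf a * g) = f g) :
    IsCentreBlind W :=
  (isTwistBlind_of_plaquetteAction hW hf).isCentreBlind

end Summit.Ventures.YMGap.RobustBall

end
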